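import Literature.Geometry.Kaehler.ComplexTorusIntegralHodgeLatticeSignatureClosedForm
import HarnessLib

/-!
# The transcendental lattices `Hdgᵖ(X, ℤ)^⊥ ⊂ (H^{2p}(X, ℤ), B_{2p})` of a polarised abelian variety in EVERY degree:
# `(b⁺, b⁻)`, rank, `Hdg ∩ Hdg^⊥ = 0`, non-degeneracy, finite index

Layer `Literature/Geometry/Kaehler`, namespace `Literature.Geometry.Kaehler.ComplexTorus`; lane `lit-hodgefound`
(Track 2 foundations library), seat p09, generation 46, row g46-#2. THEOREMS ONLY (0 definitions); no named fact,
net debt 0. Sequel of g46-#1 (`ComplexTorusIntegralHodgeLatticeSignatureClosedForm`: `B_{2p}|_{Hdgᵖ(X, ℤ)}` is non-degenerate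
in every degree with `(b⁺, b⁻)(s·B_{2p}|_{Hdgᵖ(X, ℤ)}) = (Σ_{i ≤ p even} ρ^{(i)}_pr, Σ_{i ≤ p odd} ρ^{(i)}_pr)`) and the all-degree
form of g44-#5 (`ComplexTorusTranscendentalLatticeLefschetzSignature`, degree `2`: the transcendental lattice
`(NS(X)^⊥, s·B₂) = (2h^{2,0}, h^{1,1} − ρ)`): now that the Gram determinant of `Hdgᵖ(X, ℤ)` is known to be non-zero in EVERY
degree, g44-#5's §0 lattice lemma `b^±(B) = b^±(B|L) + b^±(B|L^⊥)` splits Voisin's count (6.12) of the indices of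
`(H^{2p}(X, ℤ), s·B_{2p})` (g44-#3) into the Hodge part (g46-#1) and its orthogonal complement, the TRANSCENDENTAL LATTICE
`T^{2p}(X, ℤ) := Hdgᵖ(X, ℤ)^{⊥B} ⊂ H^{2p}(X, ℤ)` of degree `2p` FOR THE LEFSCHETZ FORM `B_{2p}` (same degree). (The complementary-degree
annihilator of `Hdg^{k,p}(X, ℤ)` under the cup product `Hᵏ × H^{2g−k} → ℤ`, and its rank `C(2g, l) − rk Hdg`, is g31-#11
`ComplexTorusTranscendentalLatticeAllDegrees`; the two agree in the middle degree `2p = g`, where `B_g` is the cup product.)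

## Dictionary

`X = E/Φ(ℤ^ι)` a polarised abelian variety of dimension `g = j + 2` and type `(d₁, …, d_g)` (`IsPolarizationType Φ η d`, ANY
presentation, any orientation `e : Fin n ≃ ι`, `sign = orientationSign Φ e`); `k = 2p` with complementary half-degree `q`,
`k + q = g`; `γ_q` the integral minimal class (`q!·d₁⋯d_q·γ_q = θ^{∧q}`, hypothesis `hγ`); `B = B_k(x, y) = ⟨x, γ_q ∧ y⟩_e` on
`Hᵏ(X, ℤ) = integralForms Φ k` (hypothesis `hB`), `s = sign·(−1)^q`; `Hdg = Hdgᵖ(X, ℤ) = Hᵏ(X, ℤ) ∩ H^{p,p}` as the `ℤ`-submodule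
`AddSubgroup.toIntSubmodule ((integralHodgeClassesIn Φ k p).addSubgroupOf (integralForms Φ k))`; `T = B.orthogonal Hdg` the
transcendental lattice; `ρ^{(i)}_pr = finrank ℤ (integralHodgeClassesIn Φ (2i) i ⊓ (primitiveForms η (2i)).toAddSubgroup)` the primitive
Hodge ranks; `h_pr^{a,b} = primitiveHodgeNumber g a b = C(g,a)C(g,b) − C(g,a−1)C(g,b−1)`, summed over Voisin's index sets
`evenPieceIdx k` / `oddPieceIdx k` (triples `(s, a, b)`, `2s + a + b = k`, `a` even / odd).

## What is proved

* §1 `IsPolarizationType.sigPos_sigNeg_smul_restrict_transcendental_add_of_eq_poincarePairing_wedge`: **`b⁺(s·B|_T) + Σ_{i ≤ p, i even} ρ^{(i)}_pr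
  = Σ_{evenPieceIdx 2p} h_pr^{a,b}` and `b⁻(s·B|_T) + Σ_{i ≤ p, i odd} ρ^{(i)}_pr = Σ_{oddPieceIdx 2p} h_pr^{a,b}`** — the indices of
  inertia of the transcendental lattice of degree `2p` (stated additively, no truncated subtraction);
  `IsPolarizationType.finrank_nondegenerate_transcendental_allDegrees_of_eq_poincarePairing_wedge`: **`rk T + Σ_{i ≤ p} ρ^{(i)}_pr = C(2g, 2p)`,
  `Hdg ∩ T = 0`, `B|_T` non-degenerate, `0 < [H^{2p}(X, ℤ) : Hdg ⊕ T]`**, and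
  `IsPolarizationType.index_hodge_sup_transcendental_dvd`: **`[H^{2p}(X, ℤ) : Hdg ⊕ T] ∣ |det G_{Hdg}|`** for every `ℤ`-basis of
  `Hdgᵖ(X, ℤ)` (Kitaoka).
* §2 degree `2` as a check: `IsPolarizationType.sigPos_sigNeg_smul_restrict_transcendental_two_add`: `b⁺ + 1 = 1 + 2h^{2,0}` and
  `b⁻ + ρ^{(1)}_pr = h^{1,1} − 1`, i.e. g44-#5's `(2h^{2,0}, h^{1,1} − ρ)` (`ρ = 1 + ρ^{(1)}_pr`).
* §3 the middle degree of an abelian FOURFOLD (`B₄ = ` the intersection form on `H⁴(X, ℤ) ≅ ℤ⁷⁰`, `(35, 35)` by g44-#3,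
  `(1 + ρ^{(2)}_pr, ρ − 1)` on `Hdg²(X, ℤ)` by g45-#3/g46-#1): `IsPolarizationType.sigPos_sigNeg_transcendental_middle_fourfold`:
  **`(b⁺, b⁻)(sign · ⟨,⟩|_{T⁴(X, ℤ)}) = (34 − ρ^{(2)}_pr, 36 − ρ)`** (additively: `b⁺ + ρ^{(2)}_pr = 34`, `b⁻ + ρ = 36`) and
  `rk T⁴(X, ℤ) + ρ + ρ^{(2)}_pr = 70`.

## The sources, verbatim (held copies)

* C. Voisin, *Hodge Theory and Complex Algebraic Geometry I* (CUP 2002), held `book:voisin2002-hodge-theory-complex-algebraic-geometry-i`,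
  §6.3.2 p0128 L25–L29 (Lemma 6.31: the Lefschetz decomposition is orthogonal for `H_k`, `H_k = (−1)ʳ H_{k−2r}` on `Lʳ H^{k−2r}_prim`),
  L35 (Thm. 6.32: the `H^{p,q}` are `H_k`-orthogonal and `(−1)^{k(k−1)/2} i^{p−q−k} H_k > 0` on `H^{p,q}_prim`), p0129 L15–L26 (Thm. 6.33
  and the count (6.12) `sign(Q) = Σ_{a+b=n−2r} (−1)ᵃ h^{a,b}_prim`).
* T. Shioda, N. Mitani, *Singular abelian surfaces and binary quadratic forms*, LNM 412 (1974), §1 / §4 p. 172 — the transcendental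
  lattice `T_X = S_X^⊥ ⊂ H²(X, ℤ)`, signature `(2, 4 − ρ)` (the case `g = 2 = 2p`).
* D. Huybrechts, *Lectures on K3 Surfaces* (CUP 2016), held `book:huybrechtsnd-lectures-k3-surfaces`, Ch. 14 §0.1–§0.2 (orthogonal
  complements, finite index, `Λ₁ ⊕ Λ₁^⊥ ⊂ Λ`), Ch. 3 §3.3 (the transcendental lattice as `NS^⊥`).
* Y. Kitaoka, *Arithmetic of Quadratic Forms* (CUP 1993), Ch. 5 Prop. 5.3.3 (proof: `[M : L ⊥ L^⊥] ∣ det G_L`) — through p18's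
  `index_sup_orthogonal_dvd_natAbs_det` and g44-#5 §0.
* J.-P. Serre, *A Course in Arithmetic* (GTM 7, 1973), Ch. V §1.3.2 (indices of inertia of a lattice read on `E ⊗ ℝ`), §1.3.7.
* H. Lange, *Abelian Varieties over the Complex Numbers* (Springer 2023), §5.4.1 (5.22) (PDF p. 275), §5.4.2 Thm. 5.4.6 (5.29)
  (`dim H_pr^{a,b} = h^{a,b} − h^{a−1,b−1}`), §7.2.2, §1.1.3 Exercise 1.1.6 (8) (`rk Hᵏ(X, ℤ) = C(2g, k)`).

## References

* [cite: VoisinHodgeI2002, §6.3.2 Lemma 6.31, Thm. 6.32, Thm. 6.33 and (6.12) (PDF pp. 128–129); §6.2.3 Rem. 6.27]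
* [cite: ShiodaMitani1974, §1 and §4 (p. 172)]
* [cite: Huybrechts2016K3, Ch. 14 §0.1–§0.2; Ch. 3 §3.3]
* [cite: Kitaoka1993, Ch. 5 Prop. 5.3.3 (proof)]
* [cite: Serre1973, Ch. V §1.3.2 and §1.3.7]
* [cite: Lange2023AbelianVarietiesComplex, §5.4.1 (5.22) (PDF p. 275); §5.4.2 Thm. 5.4.6 (5.29); §7.2.2; §1.1.3 Exercise 1.1.6 (8)]
-/

noncomputable section

-- `Module ℂ` / `SMulZeroClass ℂ` synthesis on `E [⋀^Fin k]→L[ℝ] ℂ` (as in `ComplexTorusLefschetzDecomposition`)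
set_option maxSynthPendingDepth 3

open Module Function
open LinearMap (BilinForm)
open Literature.LinearAlgebra.Alternating
open Literature.Analysis.Complex (IsOfTypeAt typeSubmodule)

namespace Literature.Geometry.Kaehler.ComplexTorus

/-! ## §1 The transcendental lattice of degree `2p` -/

section AllDegrees

variable {ι : Type*} [Fintype ι] [DecidableEq ι] {E : Type*} [NormedAddCommGroup E] [NormedSpace ℂ E]
  {Φ : (ι → ℝ) ≃L[ℝ] E} {j n p q k : ℕ} {η : E [⋀^Fin 2]→L[ℝ] ℝ} {d : Fin (j + 2) → ℕ}

/-- Engine: a `ℤ`-basis of `Hdgᵖ(X, ℤ) ⊂ H^{2p}(X, ℤ)` with non-zero Gram determinant for `B_{2p}` (g46-#1's non-degeneracy), `B` symmetric and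
non-degenerate, `H^{2p}(X, ℤ)` finite free of rank `C(2g, 2p)`.
[cite: Lange2023AbelianVarietiesComplex, §7.2.2; §1.1.3 Exercise 1.1.6 (8)] [cite: VoisinHodgeI2002, §6.3.2 Lemma 6.31, Thm. 6.32 (PDF p. 128)] -/
private theorem exists_basis_hodge_det_ne_zero₇₄ (hd : IsPolarizationType Φ η d) (hη : IsRiemannForm Φ η) (hpk : p + p = k)
    (hkq : k + q = j + 2) (hq : q ≤ j + 2) {γ : E [⋀^Fin (2 * q)]→L[ℝ] ℂ}
    (hγ : wedgePow (ofRealForm η) q = ((q.factorial * ∏ i : Fin q, d (Fin.castLE hq i) : ℕ) : ℂ) • γ)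
    (e : Fin n ≃ ι) (hn : k + (2 * q + k) = n) {B : BilinForm ℤ ↥(integralForms Φ k)}
    (hB : ∀ x y : ↥(integralForms Φ k),
      ((B x y : ℤ) : ℂ) = poincarePairing Φ e hn (x : E [⋀^Fin k]→L[ℝ] ℂ) (γ.wedge (y : E [⋀^Fin k]→L[ℝ] ℂ))) :
    ∃ (r : ℕ) (bM : Basis (Fin r) ℤ ↥(AddSubgroup.toIntSubmodule ((integralHodgeClassesIn Φ k p).addSubgroupOf (integralForms Φ k)))),
      (LinearMap.BilinForm.toMatrix bM
        (B.restrict (AddSubgroup.toIntSubmodule ((integralHodgeClassesIn Φ k p).addSubgroupOf (integralForms Φ k))))).det ≠ 0 ∧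
      B.IsSymm ∧ B.Nondegenerate ∧ Module.Finite ℤ ↥(integralForms Φ k) ∧ Module.Free ℤ ↥(integralForms Φ k) ∧
      finrank ℤ ↥(integralForms Φ k) = (2 * (j + 2)).choose k := by
  classical
  letI : LinearOrder ι := linearOrderOfOrientation e
  let bK : Basis {w : Fin k → ι // StrictMono w} ℤ ↥(integralForms Φ k) := intLatMonomialBasis Φ k
  haveI : Module.Finite ℤ ↥(integralForms Φ k) := Module.Finite.of_basis bK
  haveI : Module.Free ℤ ↥(integralForms Φ k) := Module.Free.of_basis bK
  obtain ⟨r, bM⟩ := Submodule.basisOfPid bK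
    (AddSubgroup.toIntSubmodule ((integralHodgeClassesIn Φ k p).addSubgroupOf (integralForms Φ k)))
  have hk : Even k := ⟨p, hpk.symm⟩
  obtain ⟨hMn, -, -, -⟩ :=
    hd.nondegenerate_finrank_sigPos_sigNeg_integralHodgeClassesIn_of_eq_poincarePairing_wedge hη hpk hkq hq hγ e hn hB
  have hrk : finrank ℤ ↥(integralForms Φ k) = (2 * (j + 2)).choose k := by
    rw [← hd.card_eq]
    exact finrank_integralForms_eq_choose Φ k
  exact ⟨r, bM, (LinearMap.BilinForm.nondegenerate_iff_det_ne_zero bM).1 hMn,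
    hd.isSymm_of_eq_poincarePairing_wedge_of_even hη hk hkq hq hγ e hn hB,
    hd.nondegenerate_of_eq_poincarePairing_wedge_of_even hη hk hkq hq hγ e hn hB, inferInstance, inferInstance, hrk⟩

/-- **The indices of inertia of the transcendental lattice of degree `2p`.** For a polarised abelian variety of dimension `g = j + 2 = 2p + q`
and type `(d₁, …, d_g)` (any presentation, any orientation `e`, `sign = orientationSign Φ e`), `B = B_{2p}(x, y) = ⟨x, γ_q ∧ y⟩_e` on
`H^{2p}(X, ℤ)`, `Hdg = Hdgᵖ(X, ℤ)` and `T = Hdg^{⊥B}` the TRANSCENDENTAL LATTICE of degree `2p`: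
**`b⁺(sign·(−1)^q·B|_T) + Σ_{i ≤ p, i even} ρ^{(i)}_pr = Σ_{(s,a,b) ∈ evenPieceIdx 2p} h_pr^{a,b}` and
`b⁻(sign·(−1)^q·B|_T) + Σ_{i ≤ p, i odd} ρ^{(i)}_pr = Σ_{(s,a,b) ∈ oddPieceIdx 2p} h_pr^{a,b}`** — Voisin's count (6.12) of the indices
of `(H^{2p}(X, ℤ), s·B)` (g44-#3) splits as `b^±(H^{2p}) = b^±(Hdg) + b^±(T)` (g44-#5 §0: the Gram determinant of `Hdg` is non-zero by
g46-#1, `Hdg ⊕ T` has finite index by Kitaoka, a finite-index sublattice has the same indices by Serre), and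
`(b⁺, b⁻)(s·B|_{Hdg}) = (Σ_{i even} ρ^{(i)}_pr, Σ_{i odd} ρ^{(i)}_pr)` (g46-#1). Degree `2`: Shioda–Mitani's / g44-#5's `(2h^{2,0}, h^{1,1} − ρ)`.
[cite: VoisinHodgeI2002, §6.3.2 Lemma 6.31, Thm. 6.32, Thm. 6.33 and (6.12) (PDF pp. 128–129)] [cite: ShiodaMitani1974, §1 and §4 (p. 172)] [cite: Huybrechts2016K3, Ch. 14 §0.1–§0.2; Ch. 3 §3.3] [cite: Serre1973, Ch. V §1.3.2 and §1.3.7] [cite: Kitaoka1993, Ch. 5 Prop. 5.3.3 (proof)] -/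
theorem IsPolarizationType.sigPos_sigNeg_smul_restrict_transcendental_add_of_eq_poincarePairing_wedge
    (hd : IsPolarizationType Φ η d) (hη : IsRiemannForm Φ η) (hpk : p + p = k) (hkq : k + q = j + 2) (hq : q ≤ j + 2)
    {γ : E [⋀^Fin (2 * q)]→L[ℝ] ℂ} (hγ : wedgePow (ofRealForm η) q = ((q.factorial * ∏ i : Fin q, d (Fin.castLE hq i) : ℕ) : ℂ) • γ)
    (e : Fin n ≃ ι) (hn : k + (2 * q + k) = n) {B : BilinForm ℤ ↥(integralForms Φ k)}
    (hB : ∀ x y : ↥(integralForms Φ k),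
      ((B x y : ℤ) : ℂ) = poincarePairing Φ e hn (x : E [⋀^Fin k]→L[ℝ] ℂ) (γ.wedge (y : E [⋀^Fin k]→L[ℝ] ℂ))) :
    sigPos (((orientationSign Φ e * (-1) ^ q) • B).restrict
        (B.orthogonal (AddSubgroup.toIntSubmodule ((integralHodgeClassesIn Φ k p).addSubgroupOf (integralForms Φ k))))).toQuadraticMap +
        ∑ i ∈ (Finset.range (p + 1)).filter Even, finrank ℤ ↥(integralHodgeClassesIn Φ (2 * i) i ⊓ (primitiveForms η (2 * i)).toAddSubgroup) =
      ∑ x ∈ evenPieceIdx k, primitiveHodgeNumber (j + 2) x.2.1 x.2.2 ∧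
    sigNeg (((orientationSign Φ e * (-1) ^ q) • B).restrict
        (B.orthogonal (AddSubgroup.toIntSubmodule ((integralHodgeClassesIn Φ k p).addSubgroupOf (integralForms Φ k))))).toQuadraticMap +
        ∑ i ∈ (Finset.range (p + 1)).filter Odd, finrank ℤ ↥(integralHodgeClassesIn Φ (2 * i) i ⊓ (primitiveForms η (2 * i)).toAddSubgroup) =
      ∑ x ∈ oddPieceIdx k, primitiveHodgeNumber (j + 2) x.2.1 x.2.2 := by
  classical
  have hk : Even k := ⟨p, hpk.symm⟩
  obtain ⟨r, bM, hdet, hBs, -, hfin, -, -⟩ := exists_basis_hodge_det_ne_zero₇₄ hd hη hpk hkq hq hγ e hn hB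
  haveI := hfin
  have hs0 : orientationSign Φ e * (-1) ^ q ≠ 0 :=
    mul_ne_zero (by rcases orientationSign_eq_or Φ e with h | h <;> rw [h] <;> norm_num) (pow_ne_zero _ (by norm_num))
  -- the Gram determinant of `s • B` on `Hdg` is non-zero as well
  have hres : ((orientationSign Φ e * (-1) ^ q) • B).restrict
      (AddSubgroup.toIntSubmodule ((integralHodgeClassesIn Φ k p).addSubgroupOf (integralForms Φ k))) =
      (orientationSign Φ e * (-1) ^ q) •
        B.restrict (AddSubgroup.toIntSubmodule ((integralHodgeClassesIn Φ k p).addSubgroupOf (integralForms Φ k))) := rfl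
  have hdet' : (LinearMap.BilinForm.toMatrix bM (((orientationSign Φ e * (-1) ^ q) • B).restrict
      (AddSubgroup.toIntSubmodule ((integralHodgeClassesIn Φ k p).addSubgroupOf (integralForms Φ k))))).det ≠ 0 := by
    rw [hres, map_smul, Matrix.det_smul]
    exact mul_ne_zero (pow_ne_zero _ hs0) hdet
  have hsum := sigPos_sigNeg_eq_add_restrict_orthogonal_of_det_ne_zero ((orientationSign Φ e * (-1) ^ q) • B)
    (LinearMap.BilinForm.isSymm_smul_of_isSymm _ _ hBs) _ bM hdet'
  rw [orthogonal_smul_eq_of_ne_zero B hs0] at hsum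
  obtain ⟨hP, hN⟩ := hd.sigPos_sigNeg_smul_of_eq_poincarePairing_wedge_of_even hη hk hkq hq hγ e hn hB
  obtain ⟨-, -, hPM, hNM⟩ :=
    hd.nondegenerate_finrank_sigPos_sigNeg_integralHodgeClassesIn_of_eq_poincarePairing_wedge hη hpk hkq hq hγ e hn hB
  rw [hP, hPM] at hsum
  have hN' := hsum.2
  rw [hN, hNM] at hN'
  constructor
  · rw [hsum.1, add_comm]
  · rw [hN', add_comm]

/-- **Rank, disjointness, non-degeneracy and finite index of the transcendental lattice of degree `2p`**: with the notation of the previous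
theorem, **`rk T + Σ_{i ≤ p} ρ^{(i)}_pr = rk H^{2p}(X, ℤ) = C(2g, 2p)`, `Hdg ∩ T = 0`, `B|_T` is non-degenerate, and `Hdg ⊕ T` has finite
(positive) index in `H^{2p}(X, ℤ)`** — `B|_{Hdg}` is non-degenerate with `rk Hdg = Σ_{i ≤ p} ρ^{(i)}_pr` (g46-#1), so `rk Hdg + rk Hdg^⊥ = rk`,
`Hdg ∩ Hdg^⊥ = 0`, `B|_{Hdg^⊥}` is non-degenerate (`B` is) and `[H^{2p} : Hdg ⊕ Hdg^⊥]` divides `|det G_{Hdg}| ≠ 0` (Kitaoka).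
[cite: Huybrechts2016K3, Ch. 14 §0.1–§0.2] [cite: Kitaoka1993, Ch. 5 Prop. 5.3.3 (proof)] [cite: ShiodaMitani1974, §1] [cite: Lange2023AbelianVarietiesComplex, §1.1.3 Exercise 1.1.6 (8); §7.2.2] -/
theorem IsPolarizationType.finrank_nondegenerate_transcendental_allDegrees_of_eq_poincarePairing_wedge
    (hd : IsPolarizationType Φ η d) (hη : IsRiemannForm Φ η) (hpk : p + p = k) (hkq : k + q = j + 2) (hq : q ≤ j + 2)
    {γ : E [⋀^Fin (2 * q)]→L[ℝ] ℂ} (hγ : wedgePow (ofRealForm η) q = ((q.factorial * ∏ i : Fin q, d (Fin.castLE hq i) : ℕ) : ℂ) • γ)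
    (e : Fin n ≃ ι) (hn : k + (2 * q + k) = n) {B : BilinForm ℤ ↥(integralForms Φ k)}
    (hB : ∀ x y : ↥(integralForms Φ k),
      ((B x y : ℤ) : ℂ) = poincarePairing Φ e hn (x : E [⋀^Fin k]→L[ℝ] ℂ) (γ.wedge (y : E [⋀^Fin k]→L[ℝ] ℂ))) :
    finrank ℤ ↥(B.orthogonal (AddSubgroup.toIntSubmodule ((integralHodgeClassesIn Φ k p).addSubgroupOf (integralForms Φ k)))) +
        ∑ i ∈ Finset.range (p + 1), finrank ℤ ↥(integralHodgeClassesIn Φ (2 * i) i ⊓ (primitiveForms η (2 * i)).toAddSubgroup) =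
      (2 * (j + 2)).choose k ∧
    AddSubgroup.toIntSubmodule ((integralHodgeClassesIn Φ k p).addSubgroupOf (integralForms Φ k)) ⊓
        B.orthogonal (AddSubgroup.toIntSubmodule ((integralHodgeClassesIn Φ k p).addSubgroupOf (integralForms Φ k))) = ⊥ ∧
    (B.restrict (B.orthogonal (AddSubgroup.toIntSubmodule ((integralHodgeClassesIn Φ k p).addSubgroupOf (integralForms Φ k))))).Nondegenerate ∧
    0 < (AddSubgroup.toIntSubmodule ((integralHodgeClassesIn Φ k p).addSubgroupOf (integralForms Φ k)) ⊔
        B.orthogonal (AddSubgroup.toIntSubmodule ((integralHodgeClassesIn Φ k p).addSubgroupOf (integralForms Φ k)))).toAddSubgroup.index := by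
  classical
  obtain ⟨r, bM, hdet, hBs, hBn, hfin, hfree, hrk⟩ := exists_basis_hodge_det_ne_zero₇₄ hd hη hpk hkq hq hγ e hn hB
  haveI := hfin
  haveI := hfree
  obtain ⟨hMn, hrkM, -, -⟩ :=
    hd.nondegenerate_finrank_sigPos_sigNeg_integralHodgeClassesIn_of_eq_poincarePairing_wedge hη hpk hkq hq hγ e hn hB
  have hadd := LinearMap.BilinForm.finrank_add_finrank_orthogonal_of_nondegenerate B
    (AddSubgroup.toIntSubmodule ((integralHodgeClassesIn Φ k p).addSubgroupOf (integralForms Φ k))) hBs hMn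
  rw [hrkM, hrk] at hadd
  exact ⟨by omega, inf_orthogonal_eq_bot_of_det_ne_zero B _ bM hdet, nondegenerate_restrict_orthogonal_of_det_ne_zero B hBs hBn _ bM hdet,
    Literature.Topology.FourManifolds.index_sup_orthogonal_pos B _ hBs bM hdet⟩

/-- **`[H^{2p}(X, ℤ) : Hdgᵖ(X, ℤ) ⊕ T] ∣ |det G_{Hdg}|`** for EVERY `ℤ`-basis `c` of the integral Hodge lattice `Hdgᵖ(X, ℤ)` and its Gram matrix
`G_{Hdg}` for `B_{2p}` (Kitaoka's Prop. 5.3.3: `M/(L ⊥ L^⊥) ↪ L^♯/L`; here `det G_{Hdg} ≠ 0` by g46-#1), together with `det G_{Hdg} ≠ 0` itself.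
[cite: Kitaoka1993, Ch. 5 Prop. 5.3.3 (proof)] [cite: Huybrechts2016K3, Ch. 14 §0.1–§0.2] -/
theorem IsPolarizationType.index_hodge_sup_transcendental_dvd (hd : IsPolarizationType Φ η d) (hη : IsRiemannForm Φ η)
    (hpk : p + p = k) (hkq : k + q = j + 2) (hq : q ≤ j + 2) {γ : E [⋀^Fin (2 * q)]→L[ℝ] ℂ}
    (hγ : wedgePow (ofRealForm η) q = ((q.factorial * ∏ i : Fin q, d (Fin.castLE hq i) : ℕ) : ℂ) • γ)
    (e : Fin n ≃ ι) (hn : k + (2 * q + k) = n) {B : BilinForm ℤ ↥(integralForms Φ k)}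
    (hB : ∀ x y : ↥(integralForms Φ k),
      ((B x y : ℤ) : ℂ) = poincarePairing Φ e hn (x : E [⋀^Fin k]→L[ℝ] ℂ) (γ.wedge (y : E [⋀^Fin k]→L[ℝ] ℂ)))
    {κ : Type*} [Fintype κ] [DecidableEq κ]
    (c : Basis κ ℤ ↥(AddSubgroup.toIntSubmodule ((integralHodgeClassesIn Φ k p).addSubgroupOf (integralForms Φ k)))) :
    (LinearMap.BilinForm.toMatrix c
        (B.restrict (AddSubgroup.toIntSubmodule ((integralHodgeClassesIn Φ k p).addSubgroupOf (integralForms Φ k))))).det ≠ 0 ∧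
    (AddSubgroup.toIntSubmodule ((integralHodgeClassesIn Φ k p).addSubgroupOf (integralForms Φ k)) ⊔
        B.orthogonal (AddSubgroup.toIntSubmodule ((integralHodgeClassesIn Φ k p).addSubgroupOf (integralForms Φ k)))).toAddSubgroup.index ∣
      (LinearMap.BilinForm.toMatrix c
        (B.restrict (AddSubgroup.toIntSubmodule ((integralHodgeClassesIn Φ k p).addSubgroupOf (integralForms Φ k))))).det.natAbs := by
  have hk : Even k := ⟨p, hpk.symm⟩
  obtain ⟨hMn, -, -, -⟩ :=
    hd.nondegenerate_finrank_sigPos_sigNeg_integralHodgeClassesIn_of_eq_poincarePairing_wedge hη hpk hkq hq hγ e hn hB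
  have hdet := (LinearMap.BilinForm.nondegenerate_iff_det_ne_zero c).1 hMn
  exact ⟨hdet, Literature.Topology.FourManifolds.index_sup_orthogonal_dvd_natAbs_det B _
    (hd.isSymm_of_eq_poincarePairing_wedge_of_even hη hk hkq hq hγ e hn hB) c hdet⟩

end AllDegrees

/-! ## §2 Degree `2`: the transcendental lattice `NS(X)^⊥`, `(2h^{2,0}, h^{1,1} − ρ)` recovered -/

section DegreeTwo

variable {ι : Type*} [Fintype ι] [DecidableEq ι] {E : Type*} [NormedAddCommGroup E] [NormedSpace ℂ E]
  {Φ : (ι → ℝ) ≃L[ℝ] E} {j n : ℕ} {η : E [⋀^Fin 2]→L[ℝ] ℝ} {d : Fin (j + 2) → ℕ}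

/-- **Degree `2` (consistency with g44-#5 / Shioda–Mitani): `b⁺(s·B₂|_{T²}) + 1 = 1 + 2h^{2,0}` and `b⁻(s·B₂|_{T²}) + ρ^{(1)}_pr = h^{1,1} − 1`**,
`T² = Hdg¹(X, ℤ)^⊥ = NS(X)^⊥ ⊂ H²(X, ℤ)`, `s = sign·(−1)^j`, `h^{2,0} = C(g, 2)`, `h^{1,1} − 1 = g² − 1` primitive, `ρ = 1 + ρ^{(1)}_pr` (g46-#1): so
`(b⁺, b⁻) = (2h^{2,0}, h^{1,1} − ρ)`, the transcendental lattice of g44-#5 (surface: `(2, 4 − ρ)`). The pieces of `H²`: `L H_pr^{0,0}`,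
`H_pr^{2,0}`, `H_pr^{0,2}` (sign `+`) and `H_pr^{1,1}` (sign `−`). [cite: ShiodaMitani1974, §1 ("signature `(2, 4 − ρ)`")] [cite: VoisinHodgeI2002, §6.3.2 Thm. 6.33 and (6.12) (PDF p. 129)] [cite: Huybrechts2005, Cor. 3.3.16] [cite: Huybrechts2016K3, Ch. 3 §3.3] -/
theorem IsPolarizationType.sigPos_sigNeg_smul_restrict_transcendental_two_add (hd : IsPolarizationType Φ η d)
    (hη : IsRiemannForm Φ η) (hq : j ≤ j + 2) {γ : E [⋀^Fin (2 * j)]→L[ℝ] ℂ}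
    (hγ : wedgePow (ofRealForm η) j = ((j.factorial * ∏ i : Fin j, d (Fin.castLE hq i) : ℕ) : ℂ) • γ)
    (e : Fin n ≃ ι) (hn : 2 + (2 * j + 2) = n) {B : BilinForm ℤ ↥(integralForms Φ 2)}
    (hB : ∀ x y : ↥(integralForms Φ 2),
      ((B x y : ℤ) : ℂ) = poincarePairing Φ e hn (x : E [⋀^Fin 2]→L[ℝ] ℂ) (γ.wedge (y : E [⋀^Fin 2]→L[ℝ] ℂ))) :
    sigPos (((orientationSign Φ e * (-1) ^ j) • B).restrict
        (B.orthogonal (AddSubgroup.toIntSubmodule ((integralHodgeClassesIn Φ 2 1).addSubgroupOf (integralForms Φ 2))))).toQuadraticMap + 1 =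
      primitiveHodgeNumber (j + 2) 0 0 + (primitiveHodgeNumber (j + 2) 2 0 + primitiveHodgeNumber (j + 2) 0 2) ∧
    sigNeg (((orientationSign Φ e * (-1) ^ j) • B).restrict
        (B.orthogonal (AddSubgroup.toIntSubmodule ((integralHodgeClassesIn Φ 2 1).addSubgroupOf (integralForms Φ 2))))).toQuadraticMap +
        finrank ℤ ↥(integralHodgeClassesIn Φ 2 1 ⊓ (primitiveForms η 2).toAddSubgroup) =
      primitiveHodgeNumber (j + 2) 1 1 := by
  obtain ⟨hP, hN⟩ := hd.sigPos_sigNeg_smul_restrict_transcendental_add_of_eq_poincarePairing_wedge hη (show 1 + 1 = 2 from rfl)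
    (show 2 + j = j + 2 by omega) hq hγ e hn hB
  rw [Finset.sum_filter, Finset.sum_range_succ, Finset.sum_range_succ, Finset.sum_range_zero, zero_add,
    if_pos (by decide : Even 0), if_neg (by decide : ¬ Even 1), add_zero,
    finrank_integralHodgeClassesIn_inf_primitiveForms_congr Φ η (Nat.mul_zero 2) 0,
    finrank_integralHodgeClassesIn_inf_primitiveForms_zero Φ η, evenPieceIdx_two] at hP
  rw [Finset.sum_filter, Finset.sum_range_succ, Finset.sum_range_succ, Finset.sum_range_zero, zero_add,
    if_neg (by decide : ¬ Odd 0), if_pos (by decide : Odd 1), zero_add,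
    finrank_integralHodgeClassesIn_inf_primitiveForms_congr Φ η (Nat.mul_one 2) 1, oddPieceIdx_two, Finset.sum_singleton] at hN
  refine ⟨?_, hN⟩
  rw [hP, Finset.sum_insert (by decide), Finset.sum_insert (by decide), Finset.sum_singleton]
  ring

end DegreeTwo

/-! ## §3 The middle degree of an abelian fourfold: `(b⁺, b⁻)(sign · ⟨,⟩|_{T⁴(X, ℤ)}) = (34 − ρ^{(2)}_pr, 36 − ρ)` -/

section Fourfold

variable {ι : Type*} [Fintype ι] [DecidableEq ι] {E : Type*} [NormedAddCommGroup E] [NormedSpace ℂ E]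
  {Φ : (ι → ℝ) ≃L[ℝ] E} {n : ℕ} {η : E [⋀^Fin 2]→L[ℝ] ℝ} {d : Fin (2 + 2) → ℕ}

/-- **The transcendental part of the middle lattice of a polarised abelian FOURFOLD**: for `B₄(x, y) = ⟨x, y⟩_e = ⟨x, θ^{∧0} ∧ y⟩_e` the
intersection form on `H⁴(X, ℤ) ≅ ℤ⁷⁰` (`(b⁺, b⁻) = (35, 35)`, g44-3) and `T⁴(X, ℤ) = Hdg²(X, ℤ)^⊥`: **`b⁺(sign·B₄|_{T⁴}) + ρ^{(2)}_pr = 34`,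
`b⁻(sign·B₄|_{T⁴}) + ρ = 36` and `rk T⁴(X, ℤ) + ρ + ρ^{(2)}_pr = 70`** (`ρ = rk NS(X) = 1 + ρ^{(1)}_pr`, `ρ^{(2)}_pr = rk (Hdg²(X, ℤ) ∩ P⁴)`;
`(1 + ρ^{(2)}_pr, ρ − 1)` sits on `Hdg²(X, ℤ)`, g45-#3 / g46-#1): the intersection form on the transcendental middle cohomology of an abelian
fourfold has signature **`(34 − ρ^{(2)}_pr, 36 − ρ)`**. [cite: VoisinHodgeI2002, §6.3.2 Thm. 6.33 and (6.12) (PDF p. 129)] [cite: Lange2023AbelianVarietiesComplex, §5.4.2 Thm. 5.4.6 (5.29); §7.2.2] [cite: Huybrechts2016K3, Ch. 14 §0.1–§0.2] [cite: Serre1973, Ch. V §1.3.2] -/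
theorem IsPolarizationType.sigPos_sigNeg_transcendental_middle_fourfold (hd : IsPolarizationType Φ η d) (hη : IsRiemannForm Φ η)
    (e : Fin n ≃ ι) (hn : 4 + (2 * 0 + 4) = n) {B : BilinForm ℤ ↥(integralForms Φ 4)}
    (hB : ∀ x y : ↥(integralForms Φ 4), ((B x y : ℤ) : ℂ) =
      poincarePairing Φ e hn (x : E [⋀^Fin 4]→L[ℝ] ℂ) ((wedgePow (ofRealForm η) 0).wedge (y : E [⋀^Fin 4]→L[ℝ] ℂ))) :
    sigPos (((orientationSign Φ e) • B).restrict
        (B.orthogonal (AddSubgroup.toIntSubmodule ((integralHodgeClassesIn Φ 4 2).addSubgroupOf (integralForms Φ 4))))).toQuadraticMap +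
        finrank ℤ ↥(integralHodgeClassesIn Φ 4 2 ⊓ (primitiveForms η 4).toAddSubgroup) = 34 ∧
    sigNeg (((orientationSign Φ e) • B).restrict
        (B.orthogonal (AddSubgroup.toIntSubmodule ((integralHodgeClassesIn Φ 4 2).addSubgroupOf (integralForms Φ 4))))).toQuadraticMap +
        finrank ℤ ↥(neronSeveriGroup Φ) = 36 ∧
    finrank ℤ ↥(B.orthogonal (AddSubgroup.toIntSubmodule ((integralHodgeClassesIn Φ 4 2).addSubgroupOf (integralForms Φ 4)))) +
        finrank ℤ ↥(neronSeveriGroup Φ) + finrank ℤ ↥(integralHodgeClassesIn Φ 4 2 ⊓ (primitiveForms η 4).toAddSubgroup) = 70 := by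
  have hq : 0 ≤ 2 + 2 := Nat.zero_le _
  have hγ : wedgePow (ofRealForm η) 0 =
      (((Nat.factorial 0) * ∏ i : Fin 0, d (Fin.castLE hq i) : ℕ) : ℂ) • wedgePow (ofRealForm η) 0 := by
    simp
  obtain ⟨hP, hN⟩ := hd.sigPos_sigNeg_smul_restrict_transcendental_add_of_eq_poincarePairing_wedge hη (show 2 + 2 = 4 from rfl)
    (show 4 + 0 = 2 + 2 from rfl) hq hγ e hn hB
  obtain ⟨hrk, -, -, -⟩ := hd.finrank_nondegenerate_transcendental_allDegrees_of_eq_poincarePairing_wedge hη (show 2 + 2 = 4 from rfl)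
    (show 4 + 0 = 2 + 2 from rfl) hq hγ e hn hB
  have h35 : ∑ x ∈ evenPieceIdx 4, primitiveHodgeNumber (2 + 2) x.2.1 x.2.2 = 35 := by decide
  have h35' : ∑ x ∈ oddPieceIdx 4, primitiveHodgeNumber (2 + 2) x.2.1 x.2.2 = 35 := by decide
  have h70 : (2 * (2 + 2)).choose 4 = 70 := by decide
  have hρ := hd.finrank_neronSeveriGroup_eq_one_add hη
  rw [h35, pow_zero, mul_one, Finset.sum_filter, Finset.sum_range_succ, Finset.sum_range_succ, Finset.sum_range_succ,
    Finset.sum_range_zero, zero_add, if_pos (by decide : Even 0), if_neg (by decide : ¬ Even 1), if_pos (by decide : Even 2), add_zero,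
    finrank_integralHodgeClassesIn_inf_primitiveForms_congr Φ η (Nat.mul_zero 2) 0, finrank_integralHodgeClassesIn_inf_primitiveForms_zero Φ η,
    finrank_integralHodgeClassesIn_inf_primitiveForms_congr Φ η (show 2 * 2 = 4 from rfl) 2] at hP
  rw [h35', pow_zero, mul_one, Finset.sum_filter, Finset.sum_range_succ, Finset.sum_range_succ, Finset.sum_range_succ,
    Finset.sum_range_zero, zero_add, if_neg (by decide : ¬ Odd 0), if_pos (by decide : Odd 1), if_neg (by decide : ¬ Odd 2),
    zero_add, add_zero, finrank_integralHodgeClassesIn_inf_primitiveForms_congr Φ η (Nat.mul_one 2) 1] at hN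
  rw [h70, Finset.sum_range_succ, Finset.sum_range_succ, Finset.sum_range_succ, Finset.sum_range_zero, zero_add,
    finrank_integralHodgeClassesIn_inf_primitiveForms_congr Φ η (Nat.mul_zero 2) 0, finrank_integralHodgeClassesIn_inf_primitiveForms_zero Φ η,
    finrank_integralHodgeClassesIn_inf_primitiveForms_congr Φ η (Nat.mul_one 2) 1,
    finrank_integralHodgeClassesIn_inf_primitiveForms_congr Φ η (show 2 * 2 = 4 from rfl) 2] at hrk
  refine ⟨by omega, by omega, by omega⟩

end Fourfold

end Literature.Geometry.Kaehler.ComplexTorus
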